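import Literature.NumberTheory.Automorphic.UnitaryGroupTruncatedTraceWindowParts
import Literature.NumberTheory.Automorphic.UnitaryGroupTruncatedTraceDifferenceUnfolding
import Literature.NumberTheory.Automorphic.UnitaryGroupUnipotentHaarTorusConj
import Mathlib.Algebra.Polynomial.Degree.SmallDegree
import HarnessLib

/-!
# `J^T(f)` is affine in `log T` on `U(3)`: the law `UnitaryGroup.TruncatedTracePolynomial` from the rows
# (integrability of `k^T` + a torus Siegel set)
(Arthur, *The trace formula in invariant form*, Ann. of Math. 114 (1981), Prop. 2.3; Rogawski, *Automorphic
Representations of Unitary Groups in Three Variables* (1990), §2.1 p. 12 «each term in (2.1.1) is a polynomial in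
`T`»; Shokranian, LNM 1503 (1992), Thm. (5.7), Rem. (5.8): degree `dim(A_B/A_G) = 1`)

Topic `NumberTheory/Automorphic`; namespace `Literature.NumberTheory.Automorphic.UnitaryGroup`. THEOREMS ONLY
over accepted tree modules: no definition, no named fact, no instance, no notation, no `sorry`. The ASSEMBLY
(L2-e2) of the road to the T1-qs law ★ `UnitaryGroup.TruncatedTracePolynomial` (`UnitaryGroupArthurTruncatedTrace`
:302): for `1 ≤ T ≤ T'` above the integrability threshold,

  `J^{T'}(f) − J^{T}(f) = Σ_{j ≤ 4} ε_j (C_u ∫⁻_{G(𝔸)} β · 1_{T<H≤T'} θ_j dν_G).toReal`   (★ L2-uℂ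
  `exists_truncatedTrace_sub_eq_parts`, `θ_j = ofReal (±re ∕ ±im K_B(y,y))`, `ε_j ∈ {1, −1, i, −i}`),
  `∫⁻ β · 1_{T<H≤T'} θ_j dν_G = D · (∫⁻_{K_U} θ_j) · (log T' − log T)`   (★ L2-e1
  `exists_lintegral_weight_windowPart_eq`; the `θ_j` are `δ_B`-homogeneous by ★ `kernelBorel_borel_mul_mul`),

so `J^{T'}(f) − J^{T}(f) = D_f · (log T' − log T)` with ONE complex constant `D_f`, whence
`J^T(f) = p(log T)`, `p = C (J^{T₂} − D_f log T₂) + C D_f · X`, `deg p ≤ 1`.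

* §1 pointwise bridges: `ofReal ((1_W K_B)(y).re) = 1_W (ofReal ∘ re ∘ K_B) (y)` (four signs); homogeneity and
  measurability of the four parts.
* §2 **`truncatedTracePolynomial_of_integrable_of_torusSiegel`** — `TruncatedTracePolynomial F E c` from
  (i) `c² = 1 ≠ c`, unimodularity of `U(J₃)(𝔸_F)` and the Iwasawa decomposition `G(𝔸) = B(𝔸) K_U` (★ for CM pairs),
  (ii) the law ★-to-be `TruncatedKernelIntegrable F E c` (T1-qs law 1), (iii) a closed coordinate torus Siegel set
  meeting every `T(F)`-orbit (row H9a: EXPORT + COVER).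

## References

* J. Arthur, *The trace formula in invariant form*, Ann. of Math. 114 (1981), §2, Prop. 2.3
  [Arthur1981TraceFormulaInvariantForm].
* J. D. Rogawski, *Automorphic Representations of Unitary Groups in Three Variables*, Annals of Mathematics
  Studies 123 (1990), §2.1 (p. 12) [Rogawski1990].
* S. Shokranian, *The Selberg–Arthur Trace Formula*, LNM 1503 (1992), Thm. (5.7), Rem. (5.8) [Shokranian1992].
-/

set_option autoImplicit false

noncomputable section

open MeasureTheory Measure NumberField IsDedekindDomain Set Polynomial Literature.MeasureTheory.Group
open scoped NNReal ENNReal Pointwise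

namespace Literature.NumberTheory.Automorphic

namespace UnitaryGroup

variable {F E : Type} [Field F] [NumberField F] [Field E] [NumberField E] [Algebra F E]
  {c : E ≃ₐ[F] E}

/-! ## §1 Pointwise bridges for the four parts -/

section Parts

variable [MeasurableSpace (adelicUnipotent F E c 3)]

omit [MeasurableSpace (adelicUnipotent F E c 3)] in
/-- `ofReal (φ ((1_W K)(y))) = 1_W (ofReal ∘ φ ∘ K) (y)` for any `φ : ℂ → ℝ` with `φ 0 = 0` (the four parts
`±re, ±im`). [cite: Rogawski1990, §2.2 (p. 13)] -/
theorem ofReal_apply_indicator_eq_indicator {W : Set (quasiSplit F E c 3).Adelic}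
    {K : (quasiSplit F E c 3).Adelic → ℂ} {φ : ℂ → ℝ} (hφ : φ 0 = 0) (y : (quasiSplit F E c 3).Adelic) :
    ENNReal.ofReal (φ (W.indicator K y)) = W.indicator (fun y => ENNReal.ofReal (φ (K y))) y := by
  by_cases hy : y ∈ W
  · rw [Set.indicator_of_mem hy, Set.indicator_of_mem hy]
  · rw [Set.indicator_of_notMem hy, Set.indicator_of_notMem hy, hφ, ENNReal.ofReal_zero]

/-- **The four parts of the diagonal Borel kernel are `δ_B`-homogeneous**: for `φ ∈ {re, −re, im, −im}` (any
real-linear `φ`), `ofReal (φ (K_B(b k, b k))) = δ_B(b) · ofReal (φ (K_B(k, k)))` (★ `kernelBorel_borel_mul_mul`: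
`K_B(b x, b y) = δ_B(b) K_B(x, y)`, `δ_B ≥ 0`). [cite: Rogawski1990, §2.2 (p. 13)] -/
theorem ofReal_apply_kernelBorel_borel_mul (hc : c * c = 1) (hc1 : c ≠ 1) [BorelSpace (adelicUnipotent F E c 3)]
    (ν : Measure (adelicUnipotent F E c 3)) [ν.IsHaarMeasure] {𝓕 : Set (adelicUnipotent F E c 3)}
    (h𝓕 : IsFundamentalDomain (rationalUnipotent F E c 3) 𝓕 ν)
    {f : (quasiSplit F E c 3).Adelic → ℂ} (hfc : Continuous f) (hf : HasCompactSupport f)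
    {φ : ℂ → ℝ} (hφ : ∀ (r : ℝ) (z : ℂ), φ ((r : ℂ) * z) = r * φ z)
    (b : borelAdelic F E c 3) (k : (quasiSplit F E c 3).Adelic) :
    ENNReal.ofReal (φ (kernelBorel ν 𝓕 f ((b : (quasiSplit F E c 3).Adelic) * k) ((b : (quasiSplit F E c 3).Adelic) * k))) =
      ((torusRootModulus E 3 (diagUnit b.2) : ℝ≥0) : ℝ≥0∞) * ENNReal.ofReal (φ (kernelBorel ν 𝓕 f k k)) := by
  rw [kernelBorel_borel_mul_mul hc hc1 ν h𝓕 hfc hf b k k, Complex.real_smul, hφ,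
    ENNReal.ofReal_mul (NNReal.coe_nonneg _), ENNReal.ofReal_coe_nnreal]

end Parts

/-! ## §2 The assembly -/

/-- **`J^T(f)` IS AFFINE IN `log T` — `UnitaryGroup.TruncatedTracePolynomial F E c` FROM THE ROWS.**
Hypotheses: `c² = 1 ≠ c`; unimodularity of `U(J₃)(𝔸_F)` (`hunimod`) and the Iwasawa decomposition
`G(𝔸) = B(𝔸) K_U` (`hBK`) — both ★ for CM pairs; the law `TruncatedKernelIntegrable F E c` (`hint`, T1-qs law 1);
and a CLOSED coordinate torus Siegel set `S ⊆ T(𝔸_F)` meeting every `T(F)`-orbit whose elements have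
`d₀ ∈ C₀ · z_E(ℝ_{>0})`, `d₁ ∈ C₁` with `C₀, C₁ ⊆ 𝕀_E` compact (`hST`, row H9a: EXPORT + COVER). Conclusion: for
every Haar measure `ν` of `N(𝔸_F)`, fundamental domain `𝓕`, automorphic measure `μ` and quasi-split test function
`f` there is `p ∈ ℂ[X]` of degree `≤ 1` with `J^T(f) = p(log T)` for all large `T`
(★ `truncatedKernel_sub_truncatedKernel` ∘ ★ `exists_truncatedTrace_sub_eq_parts` ∘ ★
`exists_lintegral_weight_windowPart_eq`: `J^{T'} − J^{T} = D_f (log T' − log T)`).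
[cite: Arthur1981TraceFormulaInvariantForm, Prop. 2.3] [cite: Rogawski1990, §2.1 (p. 12)]
[cite: Shokranian1992, Thm. (5.7) and Rem. (5.8)] -/
theorem truncatedTracePolynomial_of_integrable_of_torusSiegel (hc : c * c = 1) (hc1 : c ≠ 1)
    (hunimod : ∀ [MeasurableSpace (quasiSplit F E c 3).Adelic] [BorelSpace (quasiSplit F E c 3).Adelic]
      (νG : Measure (quasiSplit F E c 3).Adelic), νG.IsHaarMeasure → νG.IsMulRightInvariant)
    (hBK : ∀ g : (quasiSplit F E c 3).Adelic, ∃ b ∈ borelAdelic F E c 3, ∃ k : (quasiSplit F E c 3).Adelic,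
      adelicVal F E c 3 ((StdForm.antidiagonal 3).over E) k ∈ standardMaximalCompactGL 3 E ∧ g = b * k)
    (hint : TruncatedKernelIntegrable F E c)
    (hST : ∃ (C₀ C₁ : Set (AdeleRing (𝓞 E) E)ˣ) (S : Set (torusInBorel F E c 3)),
      IsCompact C₀ ∧ IsCompact C₁ ∧ IsClosed S ∧
      (∀ t ∈ S, (∃ w ∈ C₀, ∃ s : ℝ, diagUnit (t : borelAdelic F E c 3).2 0 = w * posRealIdele E (expUnitNNReal s)) ∧
        diagUnit (t : borelAdelic F E c 3).2 1 ∈ C₁) ∧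
      (∀ t : torusInBorel F E c 3,
        ∃ τ : (rationalBorel F E c 3).subgroupOf (torusInBorel F E c 3), τ • t ∈ S)) :
    TruncatedTracePolynomial F E c := by
  intro mN bN ν hν 𝓕 h𝓕 μ hμ f hf
  classical
  -- structure on `G(𝔸)`: Borel σ-algebra, Haar measure (right and inversion invariant by unimodularity)
  haveI := secondCountableTopology_adeleRing E
  haveI := locallyCompactSpace_adeleRing' E
  haveI := t2Space_adeleRing_of_numberField E
  haveI : T2Space (quasiSplit F E c 3).Adelic :=
    inferInstanceAs (T2Space (adelic F E c 3 ((StdForm.antidiagonal 3).over E)))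
  haveI : LocallyCompactSpace (quasiSplit F E c 3).Adelic :=
    inferInstanceAs (LocallyCompactSpace (adelic F E c 3 ((StdForm.antidiagonal 3).over E)))
  haveI : SecondCountableTopology (quasiSplit F E c 3).Adelic :=
    inferInstanceAs (SecondCountableTopology (adelic F E c 3 ((StdForm.antidiagonal 3).over E)))
  letI : MeasurableSpace (quasiSplit F E c 3).Adelic := borel _
  haveI : BorelSpace (quasiSplit F E c 3).Adelic := ⟨rfl⟩
  obtain ⟨K₀⟩ := (inferInstance : Nonempty (TopologicalSpace.PositiveCompacts (quasiSplit F E c 3).Adelic))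
  set νG : Measure (quasiSplit F E c 3).Adelic := Measure.haarMeasure K₀ with hνG
  haveI : νG.IsMulRightInvariant := hunimod νG inferInstance
  haveI : νG.IsInvInvariant := isInvInvariant_of_isMulRightInvariant νG
  -- Haar measures on `B(𝔸)`, `K_U`, `T(𝔸)`, `N(𝔸)`
  haveI : LocallyCompactSpace (borelAdelic F E c 3) := locallyCompactSpace_borelAdelic
  haveI : T2Space (borelAdelic F E c 3) := t2Space_borelAdelic
  haveI : CompactSpace ((standardMaximalCompactGL 3 E).comap
      (adelicVal F E c 3 ((StdForm.antidiagonal 3).over E)) : Subgroup (quasiSplit F E c 3).Adelic) :=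
    isCompact_iff_compactSpace.1 isCompact_comap_adelicVal_standardMaximalCompactGL
  haveI : LocallyCompactSpace (torusInBorel F E c 3) :=
    (isTopSemidirect_borelAdelic (F := F) (E := E) (c := c) (N := 3)).isClosed_left.locallyCompactSpace
  haveI : LocallyCompactSpace (unipotentInBorel F E c 3) :=
    (isTopSemidirect_borelAdelic (F := F) (E := E) (c := c) (N := 3)).isClosed_right.locallyCompactSpace
  set μB : Measure (borelAdelic F E c 3) := Measure.haar with hμB
  set μK : Measure ((standardMaximalCompactGL 3 E).comap
      (adelicVal F E c 3 ((StdForm.antidiagonal 3).over E)) : Subgroup (quasiSplit F E c 3).Adelic) :=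
    Measure.haar with hμK
  set μT : Measure (torusInBorel F E c 3) := Measure.haar with hμT
  set μN : Measure (unipotentInBorel F E c 3) := Measure.haar with hμN
  -- `N(𝔸_F)` closed: second countable, locally compact, `ν` s-finite (for the measurability of `K_B`)
  have hNcl : IsClosed ((adelicUnipotent F E c 3 : Set (quasiSplit F E c 3).Adelic)) := by
    change IsClosed (⇑(adelicVal F E c 3 ((StdForm.antidiagonal 3).over E)) ⁻¹'
      ((upperUnitriangular (Fin 3) (AdeleRing (𝓞 E) E) : Subgroup (GL (Fin 3) (AdeleRing (𝓞 E) E))) :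
        Set (GL (Fin 3) (AdeleRing (𝓞 E) E))))
    exact (isClosed_upperUnitriangular (R := AdeleRing (𝓞 E) E)).preimage continuous_subtype_val
  haveI : SecondCountableTopology (adelicUnipotent F E c 3) := TopologicalSpace.Subtype.secondCountableTopology _
  haveI : LocallyCompactSpace (adelicUnipotent F E c 3) := hNcl.locallyCompactSpace
  haveI : SFinite ν := inferInstance
  -- the data
  have hfc : Continuous f := hf.continuous'
  have hfs : HasCompactSupport f := hf.hasCompactSupport'
  obtain ⟨T₀, hT₀⟩ := hint ν 𝓕 h𝓕 μ f hf
  obtain ⟨C₀, C₁, S, hC₀, hC₁, hSc, hS, hcov⟩ := hST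
  obtain ⟨β, hβ⟩ := exists_isCoveringWeight_arithmeticBorel_map (F := F) (E := E) (c := c) (N := 3)
  obtain ⟨Cu, -, hparts⟩ := exists_truncatedTrace_sub_eq_parts ν h𝓕 μ νG f hfc hfs hβ
  obtain ⟨D, hD⟩ := exists_lintegral_weight_windowPart_eq hc hc1 νG μB μK μT μN hBK hC₀ hC₁ hSc.measurableSet hS hcov hβ
  -- the four homogeneous parts and their `K_U`-masses
  have hKm : Measurable fun y : (quasiSplit F E c 3).Adelic => kernelBorel ν 𝓕 f y y :=
    measurable_kernelBorel_diag hfc hfs ν 𝓕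
  have hlin_re : ∀ (r : ℝ) (z : ℂ), (fun z : ℂ => z.re) ((r : ℂ) * z) = r * (fun z : ℂ => z.re) z := fun r z => by
    simp
  have hlin_nre : ∀ (r : ℝ) (z : ℂ), (fun z : ℂ => -z.re) ((r : ℂ) * z) = r * (fun z : ℂ => -z.re) z := fun r z => by
    simp
  have hlin_im : ∀ (r : ℝ) (z : ℂ), (fun z : ℂ => z.im) ((r : ℂ) * z) = r * (fun z : ℂ => z.im) z := fun r z => by
    simp
  have hlin_nim : ∀ (r : ℝ) (z : ℂ), (fun z : ℂ => -z.im) ((r : ℂ) * z) = r * (fun z : ℂ => -z.im) z := fun r z => by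
    simp
  -- the common identity for one part `φ ∈ {re, −re, im, −im}`
  have hpart : ∀ (φ : ℂ → ℝ), φ 0 = 0 → Measurable φ → (∀ (r : ℝ) (z : ℂ), φ ((r : ℂ) * z) = r * φ z) →
      ∀ T T' : ℝ≥0, 0 < T → T ≤ T' →
        ∫⁻ y, β y * ENNReal.ofReal (φ ({y : (quasiSplit F E c 3).Adelic | T < borelHeight y ∧ borelHeight y ≤ T'}.indicator
          (fun y => kernelBorel ν 𝓕 f y y) y)) ∂νG =
        D * (∫⁻ k, ENNReal.ofReal (φ (kernelBorel ν 𝓕 f (k : (quasiSplit F E c 3).Adelic) (k : (quasiSplit F E c 3).Adelic))) ∂μK) *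
          ENNReal.ofReal (Real.log (T' : ℝ) - Real.log (T : ℝ)) := by
    intro φ hφ0 hφm hφl T T' hT hTT'
    have hθm : Measurable fun y : (quasiSplit F E c 3).Adelic => ENNReal.ofReal (φ (kernelBorel ν 𝓕 f y y)) :=
      ENNReal.measurable_ofReal.comp (hφm.comp hKm)
    have h := hD (fun y => ENNReal.ofReal (φ (kernelBorel ν 𝓕 f y y))) hθm
      (fun b k _ => ofReal_apply_kernelBorel_borel_mul hc hc1 ν h𝓕 hfc hfs hφl b k) T T' hT hTT'
    rw [← h]
    refine lintegral_congr fun y => ?_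
    rw [ofReal_apply_indicator_eq_indicator hφ0]
  -- `J^{T'} − J^{T} = D_f (log T' − log T)` for `T₁ < T ≤ T'`, `T₁ = max T₀ 1`
  set a₁ : ℝ := (Cu * (D * ∫⁻ k, ENNReal.ofReal ((kernelBorel ν 𝓕 f (k : (quasiSplit F E c 3).Adelic)
    (k : (quasiSplit F E c 3).Adelic)).re) ∂μK)).toReal with ha₁
  set a₂ : ℝ := (Cu * (D * ∫⁻ k, ENNReal.ofReal (-(kernelBorel ν 𝓕 f (k : (quasiSplit F E c 3).Adelic)
    (k : (quasiSplit F E c 3).Adelic)).re) ∂μK)).toReal with ha₂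
  set a₃ : ℝ := (Cu * (D * ∫⁻ k, ENNReal.ofReal ((kernelBorel ν 𝓕 f (k : (quasiSplit F E c 3).Adelic)
    (k : (quasiSplit F E c 3).Adelic)).im) ∂μK)).toReal with ha₃
  set a₄ : ℝ := (Cu * (D * ∫⁻ k, ENNReal.ofReal (-(kernelBorel ν 𝓕 f (k : (quasiSplit F E c 3).Adelic)
    (k : (quasiSplit F E c 3).Adelic)).im) ∂μK)).toReal with ha₄
  set Df : ℂ := ((a₁ - a₂ : ℝ) : ℂ) + ((a₃ - a₄ : ℝ) : ℂ) * Complex.I with hDf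
  have hdiff : ∀ T T' : ℝ≥0, max T₀ 1 < T → T ≤ T' →
      truncatedTrace μ ν 𝓕 T' f - truncatedTrace μ ν 𝓕 T f =
        Df * (((Real.log (T' : ℝ) - Real.log (T : ℝ) : ℝ)) : ℂ) := by
    intro T T' hT hTT'
    have hT1 : 1 ≤ T := le_of_lt (lt_of_le_of_lt (le_max_right _ _) hT)
    have hT0 : 0 < T := lt_of_lt_of_le one_pos hT1
    have hTT₀ : T₀ < T := lt_of_le_of_lt (le_max_left _ _) hT
    have hlog : 0 ≤ Real.log (T' : ℝ) - Real.log (T : ℝ) :=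
      sub_nonneg.2 (Real.log_le_log (NNReal.coe_pos.2 hT0) (NNReal.coe_le_coe.2 hTT'))
    obtain ⟨-, hid⟩ := hparts T T' hT1 hTT' (hT₀ T hTT₀) (hT₀ T' (lt_of_lt_of_le hTT₀ hTT'))
    rw [hid, hpart (fun z => z.re) rfl Complex.measurable_re hlin_re T T' hT0 hTT',
      hpart (fun z => -z.re) (by simp) Complex.measurable_re.neg hlin_nre T T' hT0 hTT',
      hpart (fun z => z.im) rfl Complex.measurable_im hlin_im T T' hT0 hTT',
      hpart (fun z => -z.im) (by simp) Complex.measurable_im.neg hlin_nim T T' hT0 hTT']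
    simp only [← mul_assoc, ENNReal.toReal_mul, ENNReal.toReal_ofReal hlog]
    rw [hDf, ha₁, ha₂, ha₃, ha₄]
    simp only [ENNReal.toReal_mul]
    push_cast
    ring
  -- the polynomial
  set T₂ : ℝ≥0 := max T₀ 1 + 1 with hT₂
  have hT₂gt : max T₀ 1 < T₂ := by rw [hT₂]; exact lt_add_one _
  refine ⟨Polynomial.C Df * Polynomial.X + Polynomial.C (truncatedTrace μ ν 𝓕 T₂ f - Df * ((Real.log (T₂ : ℝ) : ℝ) : ℂ)),
    Polynomial.natDegree_linear_le, max T₀ 1, fun T hT => ?_⟩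
  rw [Polynomial.eval_add, Polynomial.eval_mul, Polynomial.eval_C, Polynomial.eval_X, Polynomial.eval_C]
  rcases le_total T T₂ with hle | hle
  · have h := hdiff T T₂ hT hle
    have : truncatedTrace μ ν 𝓕 T f = truncatedTrace μ ν 𝓕 T₂ f - Df * (((Real.log (T₂ : ℝ) - Real.log (T : ℝ) : ℝ)) : ℂ) := by
      rw [← h]; ring
    rw [this]
    push_cast
    ring
  · have h := hdiff T₂ T hT₂gt hle
    have : truncatedTrace μ ν 𝓕 T f = truncatedTrace μ ν 𝓕 T₂ f + Df * (((Real.log (T : ℝ) - Real.log (T₂ : ℝ) : ℝ)) : ℂ) := by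
      rw [← h]; ring
    rw [this]
    push_cast
    ring

end UnitaryGroup

end Literature.NumberTheory.Automorphic
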